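import Literature.Geometry.Symplectic.PALFCollarProduct
import Literature.Geometry.Symplectic.PALFRegularFibre
import Literature.Topology.FourManifolds.RegularFibreLift
import HarnessLib

/-!
# The product structure of a PALF over a box: fibre coordinates

Topic `Literature/Geometry/Symplectic` (fact seat
`provefact-Literature.Geometry.Symplectic.Oba2016_s-add47373d4`; Kas' handle count — Kas 1980,
Gompf–Stipsicz 1999 §8.2 *"`X₀ = F × D²`"*, Oba 2016 §2.2).  The product structure `Φ`, `Ψ` of
`PALF.exists_trivialisation_of_box_level` is packaged (`PALF.BoxProduct`) and read in the fibre
manifold `F° = RegularFibreOn _` (`PALFRegularFibre.lean`):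

* `PALF.BoxProduct`, `PALF.exists_boxProduct_level` — the package and its existence with the
  collar levels preserved;
* `PALF.BoxProduct.psiHat` — the retraction `Ψ` as a map into `F°`, smooth on the open tube
  `T° = f⁻¹(Q) ∩ int W` (`RegularFibreOn.contMDiffOn_lift`), with `psiHat (Φ (u, q)) = q`;
* `PALF.BoxProduct.bijective_mfderiv_fibreCoord` — **fibre coordinates**: at `x₀ ∈ T°`, with
  `g₂ = (chart of F° at psiHat x₀) ∘ psiHat`, the map `v ↦ (df v, dg₂ v)` is a linear bijection
  `T_{x₀} W → ℝ² × ℝ²` (`(u, e) ↦ Φ (u, chart⁻¹ e)` is a two-sided local inverse of `(f, g₂)`) —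
  the input of `Literature.Topology.FourManifolds.morseData_of_separateVariables`;
* `PALF.BoxProduct.horLift` — the horizontal lift `d/du Φ (u, Ψ x)` with `df (horLift x w) = w`
  and `dh (horLift x w) = 0` for every function `h` constant along `u ↦ Φ (u, Ψ x)`.

## References

* A. Kas, *On the handlebody decomposition associated to a Lefschetz fibration*, Pacific J.
  Math. 89 (1980), §1–§2. [Kas1980]
* R. E. Gompf, A. I. Stipsicz, *4-Manifolds and Kirby Calculus*, GSM 20 (1999), §8.2.
  [GompfStipsiczGSM1999]
-/

open scoped Manifold ContDiff Topology
open Set Function Filter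

noncomputable section

namespace Literature.Geometry.Symplectic

open Literature.Topology.FourManifolds

universe u

variable {W : Type u} [TopologicalSpace W] [ChartedSpace (EuclideanHalfSpace 4) W]
  [IsManifold (𝓡∂ 4) ∞ W]
  {o : SmoothOrientation (𝓡∂ 4) W} {b : BoundaryData (𝓡∂ 4) W (𝓡 3)}

namespace PALF

/-- **The product structure of a PALF over a box** (`Q = {u | ∀ i, |u i - c₀ i| < δ}`,
`F = f⁻¹(c₀)`): smooth `Φ : ℝ² × W → W`, `Ψ : W → W` with `Φ (c₀, y) = y`; `f (Φ (u, y)) = u`,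
`Ψ (Φ (u, y)) = y` for `y ∈ F`, `u ∈ Q`; `f (Ψ x) = c₀`, `Φ (f x, Ψ x) = x` for `f x ∈ Q`; `Φ` and
`Ψ` preserve `∂W` and `int W` (Kas 1980 §1, Gompf–Stipsicz 1999 §8.2; packaged output of
`PALF.exists_trivialisation_of_box`). [cite: Kas1980, §1] [cite: GompfStipsiczGSM1999, §8.2] -/
structure BoxProduct (P : PALF o b) (c₀ : EuclideanSpace ℝ (Fin 2)) (δ : ℝ) where
  /-- The product chart `Q × F → f⁻¹(Q)`, extended to `ℝ² × W`. -/
  Φ : EuclideanSpace ℝ (Fin 2) × W → W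
  /-- The retraction `f⁻¹(Q) → F`, extended to `W`. -/
  Ψ : W → W
  contMDiff_Φ : ContMDiff (𝓘(ℝ, EuclideanSpace ℝ (Fin 2)).prod (𝓡∂ 4)) (𝓡∂ 4) ∞ Φ
  contMDiff_Ψ : ContMDiff (𝓡∂ 4) (𝓡∂ 4) ∞ Ψ
  Φ_base : ∀ y, Φ (c₀, y) = y
  f_Φ : ∀ y, P.f y = c₀ → ∀ u : EuclideanSpace ℝ (Fin 2), (∀ i, |u i - c₀ i| < δ) → P.f (Φ (u, y)) = u
  Ψ_Φ : ∀ y, P.f y = c₀ → ∀ u : EuclideanSpace ℝ (Fin 2), (∀ i, |u i - c₀ i| < δ) → Ψ (Φ (u, y)) = y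
  f_Ψ : ∀ x, (∀ i, |P.f x i - c₀ i| < δ) → P.f (Ψ x) = c₀
  Φ_Ψ : ∀ x, (∀ i, |P.f x i - c₀ i| < δ) → Φ (P.f x, Ψ x) = x
  Φ_mem_boundary_iff : ∀ u y, Φ (u, y) ∈ (𝓡∂ 4).boundary W ↔ y ∈ (𝓡∂ 4).boundary W
  Ψ_mem_boundary_iff : ∀ x, Ψ x ∈ (𝓡∂ 4).boundary W ↔ x ∈ (𝓡∂ 4).boundary W

variable (P : PALF o b)

section Existence

variable [T2Space W] [CompactSpace W]

/-- **Existence of the product structure over a box, collar levels preserved**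
(`PALF.exists_trivialisation_of_box_level`, packaged). [cite: Kas1980, §1] [cite: GompfStipsiczGSM1999, §8.2] -/
theorem exists_boxProduct_level (D : FlowoutInput 3 W) {c₀ : EuclideanSpace ℝ (Fin 2)}
    {δ Δ r : ℝ} (hδΔ : δ ≤ Δ) (hr : r < 1)
    (hΔ : ∀ u : EuclideanSpace ℝ (Fin 2), (∀ i, |u i - c₀ i| ≤ Δ) → ‖u‖ ≤ r)
    (hcrit : ∀ p ∈ P.crit, ∃ i, Δ < |P.f p i - c₀ i|) :
    ∃ s₀ : ℝ, 0 < s₀ ∧ ∃ B : BoxProduct P c₀ δ,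
      (∀ y, P.f y = c₀ → D.f y < s₀ → ∀ u : EuclideanSpace ℝ (Fin 2), (∀ i, |u i - c₀ i| < δ) →
        D.f (B.Φ (u, y)) = D.f y) ∧
      ∀ x, (∀ i, |P.f x i - c₀ i| < δ) → D.f x < s₀ → D.f (B.Ψ x) = D.f x := by
  obtain ⟨s₀, hs₀, Φ, Ψ, hΦs, hΨs, hΦ0, hfib, hbox, hΦb, hΨb, hlevΦ, hlevΨ⟩ :=
    P.exists_trivialisation_of_box_level D hδΔ hr hΔ hcrit
  exact ⟨s₀, hs₀, ⟨Φ, Ψ, hΦs, hΨs, hΦ0, fun y hy u hu => (hfib y hy u hu).1,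
    fun y hy u hu => (hfib y hy u hu).2, fun x hx => (hbox x hx).1, fun x hx => (hbox x hx).2, hΦb, hΨb⟩,
    hlevΦ, hlevΨ⟩

end Existence

namespace BoxProduct

variable {P} {c₀ : EuclideanSpace ℝ (Fin 2)} {δ : ℝ} (B : BoxProduct P c₀ δ)

/-- `c₀` lies in its own open box of positive half-width. [folklore] -/
theorem self_mem_box (hδ : 0 < δ) : ∀ i, |c₀ i - c₀ i| < δ := fun i => by
  rw [sub_self, abs_zero]; exact hδ

/-- `Ψ` is the identity on the fibre `F`. [folklore] -/
theorem Ψ_eq_self (hδ : 0 < δ) {y : W} (hy : P.f y = c₀) : B.Ψ y = y := by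
  have h := B.Ψ_Φ y hy c₀ (self_mem_box hδ)
  rwa [B.Φ_base] at h

/-- `u ↦ Φ (u, y)` is smooth. [folklore] -/
theorem contMDiff_Φ_left (y : W) :
    ContMDiff 𝓘(ℝ, EuclideanSpace ℝ (Fin 2)) (𝓡∂ 4) ∞ fun u => B.Φ (u, y) :=
  B.contMDiff_Φ.comp (contMDiff_id.prodMk contMDiff_const)

/-- Points of the tube over the open box retract into `F ∩ int W` when interior. [folklore] -/
theorem Ψ_mem {x : W} (hx : ∀ i, |P.f x i - c₀ i| < δ) (hxi : (𝓡∂ 4).IsInteriorPoint x) :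
    B.Ψ x ∈ P.f ⁻¹' {c₀} ∩ (𝓡∂ 4).interior W := by
  refine ⟨B.f_Ψ x hx, ?_⟩
  by_contra h
  have hb : B.Ψ x ∈ (𝓡∂ 4).boundary W := by
    rcases (𝓡∂ 4).isInteriorPoint_or_isBoundaryPoint (B.Ψ x) with h1 | h1
    · exact absurd h1 h
    · exact h1
  exact ((𝓡∂ 4).isBoundaryPoint_iff_not_isInteriorPoint x).1 ((B.Ψ_mem_boundary_iff x).1 hb) hxi

/-! ### The retraction into the fibre manifold -/

section Fibre

variable {hF : IsRegularFibreOn (𝓡∂ 4) (show 2 + 2 = 4 from rfl) P.f c₀ ((𝓡∂ 4).interior W)}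

/-- The retraction `Ψ` as a map into the fibre manifold `F° = RegularFibreOn hF` (a default value
off the interior tube). [cite: Kas1980, §1] -/
def psiHat (hF : IsRegularFibreOn (𝓡∂ 4) (show 2 + 2 = 4 from rfl) P.f c₀ ((𝓡∂ 4).interior W))
    (q₀ : RegularFibreOn hF) (x : W) : RegularFibreOn hF := by
  classical
  exact if h : B.Ψ x ∈ P.f ⁻¹' {c₀} ∩ (𝓡∂ 4).interior W then ⟨B.Ψ x, h⟩ else q₀

/-- On the interior tube, `incl ∘ psiHat = Ψ`. [folklore] -/
theorem incl_psiHat (q₀ : RegularFibreOn hF) {x : W} (hx : ∀ i, |P.f x i - c₀ i| < δ)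
    (hxi : (𝓡∂ 4).IsInteriorPoint x) :
    RegularFibreOn.incl hF (B.psiHat hF q₀ x) = B.Ψ x := by
  classical
  unfold psiHat
  rw [dif_pos (B.Ψ_mem hx hxi)]

/-- The interior tube `T° = f⁻¹(Q) ∩ int W` is open. [folklore] -/
theorem isOpen_tube (P : PALF o b) (c₀ : EuclideanSpace ℝ (Fin 2)) (δ : ℝ) :
    IsOpen ({x : W | ∀ i, |P.f x i - c₀ i| < δ} ∩ (𝓡∂ 4).interior W) :=
  ((isOpen_setOf_forall_abs_sub_lt c₀ δ).preimage P.contMDiff.continuous).inter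
    (ModelWithCorners.isOpen_interior (I := 𝓡∂ 4) (M := W) (n := ∞) (by simp))

/-- **`psiHat` is smooth on the interior tube** (`RegularFibreOn.contMDiffOn_lift`).
[cite: Kas1980, §1] -/
theorem contMDiffOn_psiHat (q₀ : RegularFibreOn hF) :
    ContMDiffOn (𝓡∂ 4) (𝓡 2) ∞ (B.psiHat hF q₀)
      ({x : W | ∀ i, |P.f x i - c₀ i| < δ} ∩ (𝓡∂ 4).interior W) :=
  RegularFibreOn.contMDiffOn_lift hF (isOpen_tube P c₀ δ) B.contMDiff_Ψ.contMDiffOn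
    fun _ hx => B.incl_psiHat q₀ hx.1 hx.2

/-- `psiHat (Φ (u, q)) = q` for `q ∈ F°` and `u` in the open box. [folklore] -/
theorem psiHat_Φ (q₀ q : RegularFibreOn hF) {u : EuclideanSpace ℝ (Fin 2)} (hu : ∀ i, |u i - c₀ i| < δ) :
    B.psiHat hF q₀ (B.Φ (u, RegularFibreOn.incl hF q)) = q := by
  have hq : P.f (RegularFibreOn.incl hF q) = c₀ := RegularFibreOn.apply_incl hF q
  have hqi : (𝓡∂ 4).IsInteriorPoint (RegularFibreOn.incl hF q) := RegularFibreOn.isInteriorPoint_incl hF q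
  have hx : ∀ i, |P.f (B.Φ (u, RegularFibreOn.incl hF q)) i - c₀ i| < δ := by
    rw [B.f_Φ _ hq u hu]; exact hu
  have hxi : (𝓡∂ 4).IsInteriorPoint (B.Φ (u, RegularFibreOn.incl hF q)) := by
    by_contra h
    have hb : B.Φ (u, RegularFibreOn.incl hF q) ∈ (𝓡∂ 4).boundary W :=
      ((𝓡∂ 4).isInteriorPoint_or_isBoundaryPoint _).resolve_left h
    exact ((𝓡∂ 4).isBoundaryPoint_iff_not_isInteriorPoint _).1 ((B.Φ_mem_boundary_iff u _).1 hb) hqi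
  apply Subtype.ext
  show RegularFibreOn.incl hF (B.psiHat hF q₀ (B.Φ (u, RegularFibreOn.incl hF q))) = RegularFibreOn.incl hF q
  rw [B.incl_psiHat q₀ hx hxi, B.Ψ_Φ _ hq u hu]

/-- `Φ (f x, incl (psiHat x)) = x` on the interior tube. [folklore] -/
theorem Φ_incl_psiHat (q₀ : RegularFibreOn hF) {x : W} (hx : ∀ i, |P.f x i - c₀ i| < δ)
    (hxi : (𝓡∂ 4).IsInteriorPoint x) :
    B.Φ (P.f x, RegularFibreOn.incl hF (B.psiHat hF q₀ x)) = x := by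
  rw [B.incl_psiHat q₀ hx hxi, B.Φ_Ψ x hx]

end Fibre

/-! ### Fibre coordinates -/

section Coord

variable {hF : IsRegularFibreOn (𝓡∂ 4) (show 2 + 2 = 4 from rfl) P.f c₀ ((𝓡∂ 4).interior W)}

omit [IsManifold (𝓡∂ 4) ∞ W] in
/-- The differential of a pair of maps into `ℝ² × ℝ²` (normed-space valued). [folklore] -/
theorem hasMFDerivAt_pair₂ {g₁ g₂ : W → EuclideanSpace ℝ (Fin 2)} {x : W}
    {d₁ : TangentSpace (𝓡∂ 4) x →L[ℝ] EuclideanSpace ℝ (Fin 2)}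
    (h₁ : HasMFDerivAt (𝓡∂ 4) 𝓘(ℝ, EuclideanSpace ℝ (Fin 2)) g₁ x d₁)
    {d₂ : TangentSpace (𝓡∂ 4) x →L[ℝ] EuclideanSpace ℝ (Fin 2)}
    (h₂ : HasMFDerivAt (𝓡∂ 4) 𝓘(ℝ, EuclideanSpace ℝ (Fin 2)) g₂ x d₂) :
    HasMFDerivAt (𝓡∂ 4) 𝓘(ℝ, EuclideanSpace ℝ (Fin 2) × EuclideanSpace ℝ (Fin 2)) (fun y => (g₁ y, g₂ y)) x
      (d₁.prod d₂) :=
  ⟨h₁.1.prodMk h₂.1, h₁.2.prodMk h₂.2⟩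

/-- The fibre coordinate map `g₂ = (chart of F° at q) ∘ psiHat`. [cite: Kas1980, §1] -/
def fibreCoord (hF : IsRegularFibreOn (𝓡∂ 4) (show 2 + 2 = 4 from rfl) P.f c₀ ((𝓡∂ 4).interior W))
    (q : RegularFibreOn hF) (x : W) : EuclideanSpace ℝ (Fin 2) :=
  extChartAt (𝓡 2) q (B.psiHat hF q x)

/-- The domain of the fibre coordinates at `q`: the interior tube points retracting into the
chart source of `q`; it is open. [folklore] -/
theorem isOpen_fibreCoordSource (q : RegularFibreOn hF) :
    IsOpen (({x : W | ∀ i, |P.f x i - c₀ i| < δ} ∩ (𝓡∂ 4).interior W) ∩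
      B.psiHat hF q ⁻¹' (chartAt (EuclideanSpace ℝ (Fin 2)) q).source) :=
  (B.contMDiffOn_psiHat q).continuousOn.isOpen_inter_preimage (isOpen_tube P c₀ δ) (chartAt _ q).open_source

/-- The fibre coordinates are smooth on their domain. [cite: Kas1980, §1] -/
theorem contMDiffOn_fibreCoord (q : RegularFibreOn hF) :
    ContMDiffOn (𝓡∂ 4) 𝓘(ℝ, EuclideanSpace ℝ (Fin 2)) ∞ (B.fibreCoord hF q)
      (({x : W | ∀ i, |P.f x i - c₀ i| < δ} ∩ (𝓡∂ 4).interior W) ∩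
        B.psiHat hF q ⁻¹' (chartAt (EuclideanSpace ℝ (Fin 2)) q).source) :=
  contMDiffOn_extChartAt.comp ((B.contMDiffOn_psiHat q).mono inter_subset_left) fun _ hx => hx.2

/-- The local inverse `(u, e) ↦ Φ (u, incl (chart⁻¹ e))` of `(f, fibreCoord)`. [cite: Kas1980, §1] -/
def fibreCoordInv (hF : IsRegularFibreOn (𝓡∂ 4) (show 2 + 2 = 4 from rfl) P.f c₀ ((𝓡∂ 4).interior W))
    (q : RegularFibreOn hF) (p : EuclideanSpace ℝ (Fin 2) × EuclideanSpace ℝ (Fin 2)) : W :=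
  B.Φ (p.1, RegularFibreOn.incl hF ((extChartAt (𝓡 2) q).symm p.2))

/-- The local inverse is smooth at points whose second component lies in the chart target.
[folklore] -/
theorem contMDiffAt_fibreCoordInv (q : RegularFibreOn hF)
    {p : EuclideanSpace ℝ (Fin 2) × EuclideanSpace ℝ (Fin 2)} (hp : p.2 ∈ (extChartAt (𝓡 2) q).target) :
    ContMDiffAt 𝓘(ℝ, EuclideanSpace ℝ (Fin 2) × EuclideanSpace ℝ (Fin 2)) (𝓡∂ 4) ∞
      (B.fibreCoordInv hF q) p := by
  have h1 : ContMDiffAt 𝓘(ℝ, EuclideanSpace ℝ (Fin 2) × EuclideanSpace ℝ (Fin 2)) (𝓡 2) ∞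
      (fun p' : EuclideanSpace ℝ (Fin 2) × EuclideanSpace ℝ (Fin 2) => (extChartAt (𝓡 2) q).symm p'.2) p :=
    ((contMDiffOn_extChartAt_symm q).contMDiffAt ((isOpen_extChartAt_target q).mem_nhds hp)).comp p
      contDiff_snd.contMDiff.contMDiffAt
  have h2 : ContMDiffAt 𝓘(ℝ, EuclideanSpace ℝ (Fin 2) × EuclideanSpace ℝ (Fin 2))
      (𝓘(ℝ, EuclideanSpace ℝ (Fin 2)).prod (𝓡∂ 4)) ∞
      (fun p' : EuclideanSpace ℝ (Fin 2) × EuclideanSpace ℝ (Fin 2) =>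
        (p'.1, RegularFibreOn.incl hF ((extChartAt (𝓡 2) q).symm p'.2))) p :=
    contDiff_fst.contMDiff.contMDiffAt.prodMk ((RegularFibreOn.contMDiff_incl hF).contMDiffAt.comp p h1)
  exact B.contMDiff_Φ.contMDiffAt.comp p h2

/-- `(f, fibreCoord) ∘ fibreCoordInv = id` near `(f x₀, fibreCoord x₀)` for `x₀` in the interior
tube. [folklore] -/
theorem pair_fibreCoordInv_eventuallyEq {x₀ : W} (hx₀ : ∀ i, |P.f x₀ i - c₀ i| < δ)
    (hx₀i : (𝓡∂ 4).IsInteriorPoint x₀) (q : RegularFibreOn hF) (hq : q = B.psiHat hF q x₀) :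
    (fun p => (P.f (B.fibreCoordInv hF q p), B.fibreCoord hF q (B.fibreCoordInv hF q p))) =ᶠ[𝓝
      (P.f x₀, B.fibreCoord hF q x₀)] id := by
  have _ := hx₀i
  have hQ : IsOpen {u : EuclideanSpace ℝ (Fin 2) | ∀ i, |u i - c₀ i| < δ} := isOpen_setOf_forall_abs_sub_lt c₀ δ
  have hT : IsOpen (extChartAt (𝓡 2) q).target := isOpen_extChartAt_target q
  have hmem : (P.f x₀, B.fibreCoord hF q x₀) ∈ {u : EuclideanSpace ℝ (Fin 2) | ∀ i, |u i - c₀ i| < δ} ×ˢ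
      (extChartAt (𝓡 2) q).target := by
    refine ⟨hx₀, ?_⟩
    show extChartAt (𝓡 2) q (B.psiHat hF q x₀) ∈ (extChartAt (𝓡 2) q).target
    rw [← hq]; exact mem_extChartAt_target q
  filter_upwards [(hQ.prod hT).mem_nhds hmem] with p hp
  obtain ⟨hp1, hp2⟩ := hp
  set q' : RegularFibreOn hF := (extChartAt (𝓡 2) q).symm p.2 with hq'
  have hy : P.f (RegularFibreOn.incl hF q') = c₀ := RegularFibreOn.apply_incl hF q'
  refine Prod.ext ?_ ?_
  · exact B.f_Φ _ hy p.1 hp1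
  · show extChartAt (𝓡 2) q (B.psiHat hF q (B.Φ (p.1, RegularFibreOn.incl hF q'))) = p.2
    rw [B.psiHat_Φ q q' hp1, hq', (extChartAt (𝓡 2) q).right_inv hp2]

/-- `fibreCoordInv ∘ (f, fibreCoord) = id` near `x₀` in the interior tube. [folklore] -/
theorem fibreCoordInv_pair_eventuallyEq {x₀ : W} (hx₀ : ∀ i, |P.f x₀ i - c₀ i| < δ)
    (hx₀i : (𝓡∂ 4).IsInteriorPoint x₀) (q : RegularFibreOn hF) (hq : q = B.psiHat hF q x₀) :
    (fun x => B.fibreCoordInv hF q (P.f x, B.fibreCoord hF q x)) =ᶠ[𝓝 x₀] id := by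
  have hsrc : x₀ ∈ ({x : W | ∀ i, |P.f x i - c₀ i| < δ} ∩ (𝓡∂ 4).interior W) ∩
      B.psiHat hF q ⁻¹' (chartAt (EuclideanSpace ℝ (Fin 2)) q).source := by
    refine ⟨⟨hx₀, hx₀i⟩, ?_⟩
    show B.psiHat hF q x₀ ∈ (chartAt (EuclideanSpace ℝ (Fin 2)) q).source
    rw [← hq]; exact mem_chart_source _ q
  filter_upwards [(B.isOpen_fibreCoordSource q).mem_nhds hsrc] with x hx
  obtain ⟨⟨hx1, hx2⟩, hx3⟩ := hx
  show B.Φ (P.f x, RegularFibreOn.incl hF ((extChartAt (𝓡 2) q).symm (extChartAt (𝓡 2) q (B.psiHat hF q x)))) = x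
  rw [(extChartAt (𝓡 2) q).left_inv (by rwa [extChartAt_source]), B.Φ_incl_psiHat q hx1 hx2]

/-- The differential of `(f, fibreCoord)` at a point of the domain. [folklore] -/
theorem hasMFDerivAt_pair_fibreCoord (q : RegularFibreOn hF) {x : W}
    (hx : x ∈ ({x : W | ∀ i, |P.f x i - c₀ i| < δ} ∩ (𝓡∂ 4).interior W) ∩
      B.psiHat hF q ⁻¹' (chartAt (EuclideanSpace ℝ (Fin 2)) q).source) :
    HasMFDerivAt (𝓡∂ 4) 𝓘(ℝ, EuclideanSpace ℝ (Fin 2) × EuclideanSpace ℝ (Fin 2))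
      (fun y => (P.f y, B.fibreCoord hF q y)) x
      ((mfderiv (𝓡∂ 4) 𝓘(ℝ, EuclideanSpace ℝ (Fin 2)) P.f x).prod
        (mfderiv (𝓡∂ 4) 𝓘(ℝ, EuclideanSpace ℝ (Fin 2)) (B.fibreCoord hF q) x)) :=
  hasMFDerivAt_pair₂ (P.contMDiff.mdifferentiableAt (by simp)).hasMFDerivAt
    (((B.contMDiffOn_fibreCoord q).contMDiffAt ((B.isOpen_fibreCoordSource q).mem_nhds hx)).mdifferentiableAt
      (by simp)).hasMFDerivAt

/-- **Fibre coordinates: `v ↦ (df v, d(fibreCoord) v)` is a linear bijection at every point of the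
interior tube** (`fibreCoordInv` is a two-sided local inverse of `(f, fibreCoord)`; chain rule).
[cite: Kas1980, §1] [cite: GompfStipsiczGSM1999, §8.2] -/
theorem bijective_mfderiv_fibreCoord {x₀ : W} (hx₀ : ∀ i, |P.f x₀ i - c₀ i| < δ)
    (hx₀i : (𝓡∂ 4).IsInteriorPoint x₀) (q : RegularFibreOn hF) (hq : q = B.psiHat hF q x₀) :
    Bijective fun v : EuclideanSpace ℝ (Fin 4) =>
      (mfderiv (𝓡∂ 4) 𝓘(ℝ, EuclideanSpace ℝ (Fin 2)) P.f x₀ v,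
        mfderiv (𝓡∂ 4) 𝓘(ℝ, EuclideanSpace ℝ (Fin 2)) (B.fibreCoord hF q) x₀ v) := by
  set Gp : W → EuclideanSpace ℝ (Fin 2) × EuclideanSpace ℝ (Fin 2) :=
    fun y => (P.f y, B.fibreCoord hF q y) with hGp
  set Θ : EuclideanSpace ℝ (Fin 2) × EuclideanSpace ℝ (Fin 2) → W := B.fibreCoordInv hF q with hΘ
  have hsrc : x₀ ∈ ({x : W | ∀ i, |P.f x i - c₀ i| < δ} ∩ (𝓡∂ 4).interior W) ∩
      B.psiHat hF q ⁻¹' (chartAt (EuclideanSpace ℝ (Fin 2)) q).source := by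
    refine ⟨⟨hx₀, hx₀i⟩, ?_⟩
    show B.psiHat hF q x₀ ∈ (chartAt (EuclideanSpace ℝ (Fin 2)) q).source
    rw [← hq]; exact mem_chart_source _ q
  have hD := B.hasMFDerivAt_pair_fibreCoord q hsrc
  set L : EuclideanSpace ℝ (Fin 4) →L[ℝ] EuclideanSpace ℝ (Fin 2) × EuclideanSpace ℝ (Fin 2) :=
    (mfderiv (𝓡∂ 4) 𝓘(ℝ, EuclideanSpace ℝ (Fin 2)) P.f x₀).prod (mfderiv (𝓡∂ 4) 𝓘(ℝ, EuclideanSpace ℝ (Fin 2)) (B.fibreCoord hF q) x₀) with hL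
  have hGpdiff : MDifferentiableAt (𝓡∂ 4) 𝓘(ℝ, EuclideanSpace ℝ (Fin 2) × EuclideanSpace ℝ (Fin 2)) Gp x₀ := hD.mdifferentiableAt
  -- `Θ` is smooth at `Gp x₀` and `Θ (Gp x₀) = x₀`
  have hp2 : (Gp x₀).2 ∈ (extChartAt (𝓡 2) q).target := by
    show extChartAt (𝓡 2) q (B.psiHat hF q x₀) ∈ (extChartAt (𝓡 2) q).target
    rw [← hq]; exact mem_extChartAt_target q
  have hΘx₀ : Θ (Gp x₀) = x₀ := (B.fibreCoordInv_pair_eventuallyEq hx₀ hx₀i q hq).self_of_nhds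
  have hΘdiff : MDifferentiableAt 𝓘(ℝ, EuclideanSpace ℝ (Fin 2) × EuclideanSpace ℝ (Fin 2)) (𝓡∂ 4) Θ (Gp x₀) :=
    (B.contMDiffAt_fibreCoordInv q hp2).mdifferentiableAt (by simp)
  -- `dΘ ∘ dGp = id`
  have hev1 : (Θ ∘ Gp) =ᶠ[𝓝 x₀] id := B.fibreCoordInv_pair_eventuallyEq hx₀ hx₀i q hq
  have hev2 : (Gp ∘ Θ) =ᶠ[𝓝 (Gp x₀)] id := B.pair_fibreCoordInv_eventuallyEq hx₀ hx₀i q hq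
  have hA : HasMFDerivAt (𝓡∂ 4) (𝓡∂ 4) (Θ ∘ Gp) x₀
      ((mfderiv 𝓘(ℝ, EuclideanSpace ℝ (Fin 2) × EuclideanSpace ℝ (Fin 2)) (𝓡∂ 4) Θ (Gp x₀)).comp L) :=
    hΘdiff.hasMFDerivAt.comp x₀ hD
  have hA' : HasMFDerivAt (𝓡∂ 4) (𝓡∂ 4) (Θ ∘ Gp) x₀
      (ContinuousLinearMap.id ℝ (TangentSpace (𝓡∂ 4) x₀)) :=
    (hasMFDerivAt_id (I := 𝓡∂ 4) x₀).congr_of_eventuallyEq hev1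
  have h1 := hasMFDerivAt_unique hA hA'
  -- `dGp ∘ dΘ = id`
  have hDΘ : HasMFDerivAt (𝓡∂ 4) 𝓘(ℝ, EuclideanSpace ℝ (Fin 2) × EuclideanSpace ℝ (Fin 2)) Gp (Θ (Gp x₀)) L := by
    rw [hΘx₀]; exact hD
  have hB : HasMFDerivAt 𝓘(ℝ, EuclideanSpace ℝ (Fin 2) × EuclideanSpace ℝ (Fin 2))
      𝓘(ℝ, EuclideanSpace ℝ (Fin 2) × EuclideanSpace ℝ (Fin 2)) (Gp ∘ Θ) (Gp x₀)
      (L.comp (mfderiv 𝓘(ℝ, EuclideanSpace ℝ (Fin 2) × EuclideanSpace ℝ (Fin 2)) (𝓡∂ 4) Θ (Gp x₀))) :=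
    hDΘ.comp (Gp x₀) hΘdiff.hasMFDerivAt
  have hB' : HasMFDerivAt 𝓘(ℝ, EuclideanSpace ℝ (Fin 2) × EuclideanSpace ℝ (Fin 2))
      𝓘(ℝ, EuclideanSpace ℝ (Fin 2) × EuclideanSpace ℝ (Fin 2)) (Gp ∘ Θ) (Gp x₀)
      (ContinuousLinearMap.id ℝ _) :=
    (hasMFDerivAt_id (I := 𝓘(ℝ, EuclideanSpace ℝ (Fin 2) × EuclideanSpace ℝ (Fin 2))) (Gp x₀)).congr_of_eventuallyEq
      hev2
  have h2 := hasMFDerivAt_unique hB hB'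
  -- conclusion
  set T := mfderiv 𝓘(ℝ, EuclideanSpace ℝ (Fin 2) × EuclideanSpace ℝ (Fin 2)) (𝓡∂ 4) Θ (Gp x₀) with hT
  have hTL : ∀ v : EuclideanSpace ℝ (Fin 4), T (L v) = v := fun v => by
    have := ContinuousLinearMap.ext_iff.1 h1 v
    exact this
  have hLT : ∀ p : EuclideanSpace ℝ (Fin 2) × EuclideanSpace ℝ (Fin 2), L (T p) = p := fun p => by
    have := ContinuousLinearMap.ext_iff.1 h2 p
    exact this
  have hinj : Injective L := fun v w hvw => by
    rw [← hTL v, ← hTL w]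
    exact congrArg T hvw
  have hsurj : Surjective L := fun p => ⟨T p, hLT p⟩
  exact ⟨fun v w hvw => hinj (Prod.ext (congrArg Prod.fst hvw) (congrArg Prod.snd hvw)),
    fun p => by obtain ⟨v, hv⟩ := hsurj p; exact ⟨v, Prod.ext (congrArg Prod.fst hv) (congrArg Prod.snd hv)⟩⟩

end Coord

/-! ### The horizontal lift -/

section HorLift

/-- The horizontal lift of `w ∈ ℝ²` at `x`: the derivative of `u ↦ Φ (u, Ψ x)` at `u = f x`
(a vector of `T_{Φ (f x, Ψ x)} W = T_x W` over the tube). [cite: Kas1980, §1] -/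
def horLift (x : W) (w : EuclideanSpace ℝ (Fin 2)) : EuclideanSpace ℝ (Fin 4) :=
  mfderiv 𝓘(ℝ, EuclideanSpace ℝ (Fin 2)) (𝓡∂ 4) (fun u => B.Φ (u, B.Ψ x)) (P.f x) w

/-- **`df (horLift x w) = w` over the open box**: `f (Φ (u, Ψ x)) = u` for `u` near `f x`.
[cite: Kas1980, §1] -/
theorem mfderiv_apply_horLift {x : W} (hx : ∀ i, |P.f x i - c₀ i| < δ) (w : EuclideanSpace ℝ (Fin 2)) :
    mfderiv (𝓡∂ 4) 𝓘(ℝ, EuclideanSpace ℝ (Fin 2)) P.f x (B.horLift x w) = w := by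
  unfold horLift
  set γ : EuclideanSpace ℝ (Fin 2) → W := fun u => B.Φ (u, B.Ψ x) with hγ
  have hy : P.f (B.Ψ x) = c₀ := B.f_Ψ x hx
  have hγx : γ (P.f x) = x := B.Φ_Ψ x hx
  have hev : (P.f ∘ γ) =ᶠ[𝓝 (P.f x)] id := by
    filter_upwards [((isOpen_setOf_forall_abs_sub_lt c₀ δ)).mem_nhds hx] with u hu
    exact B.f_Φ _ hy u hu
  have hγd : MDifferentiableAt 𝓘(ℝ, EuclideanSpace ℝ (Fin 2)) (𝓡∂ 4) γ (P.f x) :=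
    (B.contMDiff_Φ_left (B.Ψ x)).mdifferentiableAt (by simp)
  have hfd : MDifferentiableAt (𝓡∂ 4) 𝓘(ℝ, EuclideanSpace ℝ (Fin 2)) P.f (γ (P.f x)) :=
    P.contMDiff.mdifferentiableAt (by simp)
  have h1 : mfderiv 𝓘(ℝ, EuclideanSpace ℝ (Fin 2)) 𝓘(ℝ, EuclideanSpace ℝ (Fin 2)) (P.f ∘ γ) (P.f x) =
      ContinuousLinearMap.id ℝ _ := by
    rw [hev.mfderiv_eq]; exact mfderiv_id
  have h2 := mfderiv_comp (P.f x) hfd hγd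
  have key : mfderiv (𝓡∂ 4) 𝓘(ℝ, EuclideanSpace ℝ (Fin 2)) P.f (γ (P.f x))
      (mfderiv 𝓘(ℝ, EuclideanSpace ℝ (Fin 2)) (𝓡∂ 4) γ (P.f x) w) = w := by
    have := ContinuousLinearMap.ext_iff.1 (h2.symm.trans h1) w
    exact this
  rw [hγx] at key
  exact key

/-- **Functions constant along `u ↦ Φ (u, Ψ x)` are killed by the horizontal lifts**: if
`h (Φ (u, Ψ x)) = h (Φ (f x, Ψ x))` for `u` near `f x` and `h` is differentiable at `x`, then
`dh_x (horLift x w) = 0`. [cite: Kas1980, §1] -/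
theorem mlineDeriv_horLift_eq_zero {h : W → ℝ} {x : W} (hx : ∀ i, |P.f x i - c₀ i| < δ)
    (hh : MDifferentiableAt (𝓡∂ 4) 𝓘(ℝ, ℝ) h x)
    (hconst : ∀ᶠ u in 𝓝 (P.f x), h (B.Φ (u, B.Ψ x)) = h x) (w : EuclideanSpace ℝ (Fin 2)) :
    mlineDeriv (𝓡∂ 4) h x (B.horLift x w) = 0 := by
  rw [mlineDeriv_def]
  unfold horLift
  set γ : EuclideanSpace ℝ (Fin 2) → W := fun u => B.Φ (u, B.Ψ x) with hγ
  have hγx : γ (P.f x) = x := B.Φ_Ψ x hx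
  have hev : (h ∘ γ) =ᶠ[𝓝 (P.f x)] fun _ => h x := hconst
  have hγd : MDifferentiableAt 𝓘(ℝ, EuclideanSpace ℝ (Fin 2)) (𝓡∂ 4) γ (P.f x) :=
    (B.contMDiff_Φ_left (B.Ψ x)).mdifferentiableAt (by simp)
  have hhd : MDifferentiableAt (𝓡∂ 4) 𝓘(ℝ, ℝ) h (γ (P.f x)) := by rw [hγx]; exact hh
  have h1 : mfderiv 𝓘(ℝ, EuclideanSpace ℝ (Fin 2)) 𝓘(ℝ, ℝ) (h ∘ γ) (P.f x) = 0 := by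
    rw [hev.mfderiv_eq]; exact mfderiv_const
  have h2 := mfderiv_comp (P.f x) hhd hγd
  have key : mfderiv (𝓡∂ 4) 𝓘(ℝ, ℝ) h (γ (P.f x))
      (mfderiv 𝓘(ℝ, EuclideanSpace ℝ (Fin 2)) (𝓡∂ 4) γ (P.f x) w) = 0 := by
    have := ContinuousLinearMap.ext_iff.1 (h2.symm.trans h1) w
    exact this
  rw [hγx] at key
  exact key

end HorLift


end BoxProduct

end PALF

end Literature.Geometry.Symplectic

end
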